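import Literature.NumberTheory.LFunctions.Bettin2017PrimeLevelFricke
import HarnessLib

/-!
# The dual piece of the exact central-value formula is negligible at prime level
# (Bettin 2017, Thm. 1.1 at prime level `N`, weight `2`: the `ε_f`-term, given Petersson's formula)

Topic `Literature/NumberTheory/LFunctions` (cell landau-siegel / ls-inputs, input I2 =
`bettin2017_theorem11_primeLevel`, line `hecke_afe_petersson`, stub S5 `stub_dualTail`).

In the proof of Bettin 2017, Thm. 1.1 at prime level `N`, weight `2`, trivial twist, no shift,
run with the EXACT two-sided central-value formula `L(½,f) = D_f(y) − ε_f D_f(1/(Ny))`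
(`Bettin2017.centralValue_eq_dampedTwist_sub`, `D_f(y) = Σ_{n≥1} a_f(n) e^{−2πny}/n = dampedTwist f 1 y`)
at the unbalanced height `y = 1/(mN²)`, the dual piece is the harmonic average
`Σʰ_f ε_f λ_f(m) D_f(mN)`.  This file proves that it is `O(m^{1/2} N^{−2})` (in fact exponentially
small), GIVEN Petersson's formula at prime level (Kowalski–Michel 2000, §2.4.2, the tree's named
fact `KowalskiMichel2000.kowalskiMichel2000_peterssonFormula`, input I1 of the cell):

* `KowalskiMichel2000.norm_petJ_le_all` — Kowalski–Michel's Kloosterman–Bessel term `J(l₁,l₂)` is bounded for ALL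
  indices: `‖J(l₁,l₂)‖ ≤ K √(l₁,l₂) √(l₁l₂) q^{−3/2}` (`q` prime, `l₁ ≥ 1`; Weil's bound with the crude
  gcd estimate, the tree's `norm_petKloostermanTerm_le_all`, summed over `r`); hence
  `KowalskiMichel2000.norm_petJ_level_mul_le`: `‖J(m, qn)‖ ≤ K m √n`.
* `neg_sqrt_mul_heckeLambda_mul` — the dual coefficients pointwise: `ε_f a_f(n) = −a_f(Nn)`
  (`frickeEigenvalue_mul_cuspCoeff`: `ε_f = −a_f(N)` and `a_f(N)a_f(n) = a_f(Nn)`, `N` prime) and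
  `a_f(Nn) = λ_f(Nn) (Nn)^{1/2}`, so `ε_f λ_f(m) · a_f(n) e^{−2πny}/n = −√(Nn) e^{−2πny}/n · λ_f(m)λ_f(Nn)`.
* `hasSum_harmonicSum_dual` — summing the finite harmonic average through the absolutely
  convergent `n`-series: `Σʰ_f ε_f λ_f(m) D_f(y) = −Σ_n √(Nn) e^{−2πny}/n · Σʰ_f λ_f(m)λ_f(Nn)`.
* `norm_harmonicSum_dual_le` — with Petersson `Σʰ λ_f(m)λ_f(Nn) = δ − J(m,Nn)`, `|δ − J| ≤ 1 + K m √n`,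
  the series is `≤ 4(1+K) m √N e^{−2πy}` for `y ≥ 1`.
* `dualTail_of_peterssonFormula` — the registered stub S5 `stub_dualTail` of the I2 skeleton in its
  registered shape: `‖Σʰ_f ε_f λ_f(m) D_f(mN)‖ ≤ C m^{1/2} N^{−2}` for all primes `N ≥ 1`, `m ≥ 1`
  (`x e^{−x} ≤ 6/x²`).

Everything here is proved; no definition, no named fact.  (Kowalski–Michel 2000, §2.4.2 p. 312 make
the same manipulation: "since `ε_f = −q^{1/2} λ_f(q)` … by the Hecke relation … `J(qn, m)`".)
«The programme SEARCHES and TYPES; no claim about Landau–Siegel zeros until a kernel theorem says so.»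

## References
* [Bettin2017] S. Bettin, Funct. Approx. Comment. Math. 57 (2017), Thm. 1.1, §2 Lemma 2.1–2.2.
* [KowalskiMichel2000] E. Kowalski, P. Michel, Acta Arith. 94 (2000), §2.4.2 p. 312 ((23), `J(qn,m)`).
* [Iwaniec2002] H. Iwaniec, *Spectral methods of automorphic forms*, (2.25) (Weil's bound).
-/

noncomputable section

open scoped Real
open Complex CongruenceSubgroup
open Literature.NumberTheory.EllipticCurves.ModularForms

namespace Literature.NumberTheory.LFunctions

namespace KowalskiMichel2000

/-! ### Kowalski–Michel's `J(l₁, l₂)` is polynomially bounded for all indices -/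

/-- **`J(l₁, l₂)` for arbitrary indices** (Kowalski–Michel 2000, p. 312, "from Weil's bound … and
`J₁(x) ≪ x`", with the crude gcd estimate `((l₁,l₂), qr) ≤ (l₁,l₂)`): there is `K ≥ 0` with
`‖J(l₁, l₂)‖ ≤ K √(l₁,l₂) √(l₁ l₂) q^{−3/2}` for all primes `q`, all `l₁ ≥ 1` and all `l₂`
(`K = 8π² C_{1/4} Σ_r r^{−5/4}`; termwise `norm_petKloostermanTerm_le_all`).
[cite: KowalskiMichel2000, §2.4.2 p. 312 (23)] -/
theorem norm_petJ_le_all :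
    ∃ K : ℝ, 0 ≤ K ∧ ∀ (q : ℕ) [NeZero q], q.Prime → ∀ m n : ℕ, 1 ≤ m →
      ‖petJ q m n‖ ≤ K * Real.sqrt ((m.gcd n : ℕ) : ℝ) * Real.sqrt ((m : ℝ) * n) *
        (q : ℝ) ^ (-(3 / 2 : ℝ)) := by
  obtain ⟨C₁, hC₁1, hC₁⟩ :=
    Literature.NumberTheory.Sieve.exists_card_divisors_le_mul_rpow' (by norm_num : (0 : ℝ) < 1 / 4)
  have hC₁0 : (0 : ℝ) ≤ C₁ := zero_le_one.trans hC₁1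
  have hZs : Summable (fun r : ℕ ↦ (r : ℝ) ^ (-(5 / 4 : ℝ))) :=
    Real.summable_nat_rpow.mpr (by norm_num)
  obtain ⟨Z, hZ⟩ : ∃ Z : ℝ, Z = ∑' r : ℕ, (r : ℝ) ^ (-(5 / 4 : ℝ)) := ⟨_, rfl⟩
  have hZ0 : 0 ≤ Z := hZ ▸ tsum_nonneg fun r ↦ Real.rpow_nonneg (Nat.cast_nonneg _) _
  refine ⟨8 * π ^ 2 * C₁ * Z, mul_nonneg (mul_nonneg (by positivity) hC₁0) hZ0,
    fun q _ hq m n hm ↦ ?_⟩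
  have hq0 : (0 : ℝ) < q := by exact_mod_cast hq.pos
  -- the termwise bound, summed over `r`
  obtain ⟨A, hA⟩ : ∃ A : ℝ, A = 4 * π * C₁ * Real.sqrt ((m.gcd n : ℕ) : ℝ) *
      Real.sqrt ((m : ℝ) * n) * (q : ℝ) ^ (-(1 / 2 : ℝ)) := ⟨_, rfl⟩
  have hterm : ∀ r : ℕ, ‖petKloostermanTerm q m n r‖ ≤ A * (r : ℝ) ^ (-(5 / 4 : ℝ)) :=
    fun r ↦ hA ▸ norm_petKloostermanTerm_le_all hq hm (fun k ↦ hC₁ k) r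
  have hbs : Summable (fun r : ℕ ↦ A * (r : ℝ) ^ (-(5 / 4 : ℝ))) := hZs.mul_left A
  have has : Summable (fun r : ℕ ↦ ‖petKloostermanTerm q m n r‖) :=
    Summable.of_nonneg_of_le (fun _ ↦ norm_nonneg _) hterm hbs
  have htsum : ∑' r : ℕ, ‖petKloostermanTerm q m n r‖ ≤ A * Z := by
    calc ∑' r : ℕ, ‖petKloostermanTerm q m n r‖
        ≤ ∑' r : ℕ, A * (r : ℝ) ^ (-(5 / 4 : ℝ)) := Summable.tsum_le_tsum hterm has hbs
      _ = A * Z := by rw [tsum_mul_left, hZ]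
  have hnorm : ‖(2 * π / q : ℂ)‖ = 2 * π / q := by
    rw [norm_div, norm_mul, Complex.norm_real, Complex.norm_natCast, Real.norm_eq_abs,
      abs_of_pos Real.pi_pos, Complex.norm_two]
  have hJ : ‖petJ q m n‖ ≤ 2 * π / q * (A * Z) := by
    rw [petJ_def, norm_mul, hnorm]
    exact mul_le_mul_of_nonneg_left ((norm_tsum_le_tsum_norm has).trans htsum) (by positivity)
  have hq32 : 2 * π / q * (q : ℝ) ^ (-(1 / 2 : ℝ)) = 2 * π * (q : ℝ) ^ (-(3 / 2 : ℝ)) := by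
    rw [div_eq_mul_inv, ← Real.rpow_neg_one, mul_assoc, ← Real.rpow_add hq0]
    norm_num
  calc ‖petJ q m n‖ ≤ 2 * π / q * (A * Z) := hJ
    _ = (2 * π / q * (q : ℝ) ^ (-(1 / 2 : ℝ))) * (4 * π * C₁ * Z) *
          (Real.sqrt ((m.gcd n : ℕ) : ℝ) * Real.sqrt ((m : ℝ) * n)) := by
        rw [hA]; ring
    _ = 8 * π ^ 2 * C₁ * Z * Real.sqrt ((m.gcd n : ℕ) : ℝ) * Real.sqrt ((m : ℝ) * n) *
          (q : ℝ) ^ (-(3 / 2 : ℝ)) := by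
        rw [hq32]; ring

/-- **`J(m, qn)` is polynomially bounded** (Kowalski–Michel 2000, p. 312: "(23) … the same bound
holds for `J(qn, m)`", here in the crude all-range form that needs no coprimality): there is
`K ≥ 0` with `‖J(m, q n)‖ ≤ K m √n` for all primes `q`, `m ≥ 1`, `n ≥ 0`
(`√(m, qn) ≤ √m`, `√(m q n) q^{−3/2} = √m √n q^{−1} ≤ √m √n`).
[cite: KowalskiMichel2000, §2.4.2 p. 312 (23)] -/
theorem norm_petJ_level_mul_le :
    ∃ K : ℝ, 0 ≤ K ∧ ∀ (q : ℕ) [NeZero q], q.Prime → ∀ m n : ℕ, 1 ≤ m →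
      ‖petJ q m (q * n)‖ ≤ K * m * Real.sqrt n := by
  obtain ⟨K, hK0, hK⟩ := norm_petJ_le_all
  refine ⟨K, hK0, fun q _ hq m n hm ↦ ?_⟩
  have h := hK q hq m (q * n) hm
  have hq1 : (1 : ℝ) ≤ q := by exact_mod_cast hq.one_lt.le
  have hq0 : (0 : ℝ) < q := by linarith
  have hm0 : (0 : ℝ) ≤ m := Nat.cast_nonneg m
  -- `√(m, qn) ≤ √m`
  have hg : Real.sqrt ((m.gcd (q * n) : ℕ) : ℝ) ≤ Real.sqrt m :=
    Real.sqrt_le_sqrt (by exact_mod_cast Nat.gcd_le_left (q * n) hm)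
  -- `√(m (q n)) q^{−3/2} ≤ √m √n`
  have hs : Real.sqrt ((m : ℝ) * ((q * n : ℕ) : ℝ)) * (q : ℝ) ^ (-(3 / 2 : ℝ)) ≤
      Real.sqrt m * Real.sqrt n := by
    rw [Nat.cast_mul, show (m : ℝ) * ((q : ℝ) * n) = ((m : ℝ) * n) * q by ring,
      Real.sqrt_mul (by positivity) (q : ℝ), Real.sqrt_mul hm0 (n : ℝ), Real.sqrt_eq_rpow (q : ℝ),
      mul_assoc, ← Real.rpow_add hq0, show (1 / 2 : ℝ) + -(3 / 2 : ℝ) = -1 by norm_num,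
      Real.rpow_neg_one]
    exact mul_le_of_le_one_right (by positivity) (inv_le_one_of_one_le₀ hq1)
  calc ‖petJ q m (q * n)‖
      ≤ K * Real.sqrt ((m.gcd (q * n) : ℕ) : ℝ) * Real.sqrt ((m : ℝ) * ((q * n : ℕ) : ℝ)) *
          (q : ℝ) ^ (-(3 / 2 : ℝ)) := h
    _ = K * Real.sqrt ((m.gcd (q * n) : ℕ) : ℝ) *
          (Real.sqrt ((m : ℝ) * ((q * n : ℕ) : ℝ)) * (q : ℝ) ^ (-(3 / 2 : ℝ))) := by ring
    _ ≤ K * Real.sqrt m * (Real.sqrt m * Real.sqrt n) :=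
        mul_le_mul (mul_le_mul_of_nonneg_left hg hK0) hs (by positivity) (by positivity)
    _ = K * (Real.sqrt m * Real.sqrt m) * Real.sqrt n := by ring
    _ = K * m * Real.sqrt n := by rw [Real.mul_self_sqrt hm0]

end KowalskiMichel2000

namespace Bettin2017

open KowalskiMichel2000

/-! ### The dual coefficients: `ε_f λ_f(m) a_f(n) e^{−2πny}/n = −√(Nn) e^{−2πny}/n · λ_f(m) λ_f(Nn)` -/

variable {N : ℕ} [NeZero N]

/-- **The dual coefficients pointwise** (`N` prime, `f ∈ S_2(Γ₀(N))` a newform): for every `m, n`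
and `y`, `−√(Nn) e^{−2πny}/n · λ_f(m) λ_f(Nn) = ε_f λ_f(m) · a_f(n) e^{−2πny}/n`, from
`ε_f a_f(n) = −a_f(Nn)` (`frickeEigenvalue_mul_cuspCoeff`) and `a_f(Nn) = λ_f(Nn) (Nn)^{1/2}`
(Kowalski–Michel 2000, §2.4.2: "`ε_f = −q^{1/2} λ_f(q)` … by the Hecke relation").
[cite: KowalskiMichel2000, §2.4.2 p. 312] -/
theorem neg_sqrt_mul_heckeLambda_mul (hN : N.Prime) {f : CuspForm (Gamma0 N) 2}
    (hf : IsNewform0 f) (m n : ℕ) (y : ℝ) :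
    ((-(Real.sqrt ((N : ℝ) * n) * (Real.exp (-(2 * Real.pi * n) * y) / n)) : ℝ) : ℂ) *
        (GL2Family.heckeLambda f m * GL2Family.heckeLambda f (N * n)) =
      frickeEigenvalue f * GL2Family.heckeLambda f m *
        (cuspCoeff f n * ((Real.exp (-(2 * Real.pi * n) * y) / n : ℝ) : ℂ)) := by
  rcases Nat.eq_zero_or_pos n with rfl | hn
  · simp
  · have h1 := frickeEigenvalue_mul_cuspCoeff hN hf n
    have h2 : cuspCoeff f (N * n) =
        GL2Family.heckeLambda f (N * n) * (Real.sqrt ((N : ℝ) * n) : ℂ) := by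
      rw [GL2Family.cuspCoeff_eq_heckeLambda_mul f (mul_ne_zero hN.ne_zero hn.ne'),
        Real.sqrt_eq_rpow, Complex.ofReal_cpow (by positivity)]
      push_cast
      norm_num
    rw [h2] at h1
    rw [Complex.ofReal_neg, Complex.ofReal_mul]
    linear_combination
      (-(GL2Family.heckeLambda f m * ((Real.exp (-(2 * Real.pi * n) * y) / n : ℝ) : ℂ))) * h1

/-- **The dual piece through the `n`-series** (`N` prime, `y > 0`, any `m`):
`Σʰ_f ε_f λ_f(m) D_f(y) = Σ_n (−√(Nn) e^{−2πny}/n) · Σʰ_f λ_f(m)λ_f(Nn)`, the series converging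
(absolutely): the harmonic average is a finite sum (`finite_newforms0_holds`) of absolutely convergent
series (`summable_dampedTwist`), and `Σʰ_f λ_f(m)λ_f(Nn) = KowalskiMichel2000.pet N m (Nn)`.
(Bettin 2017, §2 (2.3), first line, for the dual term of the approximate functional equation;
Kowalski–Michel 2000, §2.4.2, the `J(qn, m)`-sum.) [cite: Bettin2017, §2 (2.3)]
[cite: KowalskiMichel2000, §2.4.2 p. 312] -/
theorem hasSum_harmonicSum_dual (hN : N.Prime) (m : ℕ) {y : ℝ} (hy : 0 < y) :
    HasSum (fun n : ℕ ↦
        ((-(Real.sqrt ((N : ℝ) * n) * (Real.exp (-(2 * Real.pi * n) * y) / n)) : ℝ) : ℂ) *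
          pet N m (N * n))
      (GL2Family.harmonicSum N 2 (fun f ↦ frickeEigenvalue f * GL2Family.heckeLambda f m *
        dampedTwist f (fun _ ↦ 1) y)) := by
  have hfin := finite_newforms0_holds N 2
  -- each newform: `HasSum (n ↦ ω_f · w(n) λ_f(m)λ_f(Nn)) (ω_f · ε_f λ_f(m) D_f(y))`
  have hf1 : ∀ f ∈ hfin.toFinset, HasSum (fun n : ℕ ↦ (GL2Family.harmonicWeight f : ℂ) *
      (((-(Real.sqrt ((N : ℝ) * n) * (Real.exp (-(2 * Real.pi * n) * y) / n)) : ℝ) : ℂ) *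
        (GL2Family.heckeLambda f m * GL2Family.heckeLambda f (N * n))))
      ((GL2Family.harmonicWeight f : ℂ) * (frickeEigenvalue f * GL2Family.heckeLambda f m *
        dampedTwist f (fun _ ↦ 1) y)) := by
    intro f hf
    have hf' : IsNewform0 f := hfin.mem_toFinset.mp hf
    have hs := summable_dampedTwist f (w := fun _ ↦ (1 : ℂ)) (B := 1) (fun _ ↦ by simp) hy
    have hD : HasSum (fun n : ℕ ↦ (fun _ ↦ (1 : ℂ)) n * cuspCoeff f n *
        ((Real.exp (-(2 * Real.pi * n) * y) / n : ℝ) : ℂ)) (dampedTwist f (fun _ ↦ 1) y) :=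
      hs.hasSum
    have h2 := (hD.mul_left (frickeEigenvalue f * GL2Family.heckeLambda f m)).mul_left
      (GL2Family.harmonicWeight f : ℂ)
    have hfun : (fun n : ℕ ↦ (GL2Family.harmonicWeight f : ℂ) *
        (((-(Real.sqrt ((N : ℝ) * n) * (Real.exp (-(2 * Real.pi * n) * y) / n)) : ℝ) : ℂ) *
          (GL2Family.heckeLambda f m * GL2Family.heckeLambda f (N * n)))) =
        (fun n : ℕ ↦ (GL2Family.harmonicWeight f : ℂ) *
          (frickeEigenvalue f * GL2Family.heckeLambda f m * ((fun _ ↦ (1 : ℂ)) n * cuspCoeff f n *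
            ((Real.exp (-(2 * Real.pi * n) * y) / n : ℝ) : ℂ)))) := by
      funext n
      rw [neg_sqrt_mul_heckeLambda_mul hN hf' m n y, one_mul]
    rw [hfun]
    exact h2
  have h := hasSum_sum hf1
  have hval : ∑ f ∈ hfin.toFinset, (GL2Family.harmonicWeight f : ℂ) *
      (frickeEigenvalue f * GL2Family.heckeLambda f m * dampedTwist f (fun _ ↦ 1) y) =
      GL2Family.harmonicSum N 2 (fun f ↦ frickeEigenvalue f * GL2Family.heckeLambda f m *
        dampedTwist f (fun _ ↦ 1) y) := by
    rw [GL2Family.harmonicSum, finsum_mem_eq_finite_toFinset_sum _ hfin]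
  have hfun : (fun n : ℕ ↦ ∑ f ∈ hfin.toFinset, (GL2Family.harmonicWeight f : ℂ) *
      (((-(Real.sqrt ((N : ℝ) * n) * (Real.exp (-(2 * Real.pi * n) * y) / n)) : ℝ) : ℂ) *
        (GL2Family.heckeLambda f m * GL2Family.heckeLambda f (N * n)))) =
      (fun n : ℕ ↦
        ((-(Real.sqrt ((N : ℝ) * n) * (Real.exp (-(2 * Real.pi * n) * y) / n)) : ℝ) : ℂ) *
          pet N m (N * n)) := by
    funext n
    rw [pet, GL2Family.harmonicSum, finsum_mem_eq_finite_toFinset_sum _ hfin, Finset.mul_sum]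
    refine Finset.sum_congr rfl fun f _ ↦ ?_
    ring
  rw [hval, hfun] at h
  exact h

/-! ### The estimate -/

/-- **The dual piece is exponentially small, given Petersson's formula** (Bettin 2017, Lemma 2.1 —
the discarded dual integral — at prime level, weight `2`, run with Kowalski–Michel's Petersson
formula): there is `C ≥ 0` such that for every prime `N`, every `m ≥ 1` and every `y ≥ 1`,
`‖Σʰ_f ε_f λ_f(m) D_f(y)‖ ≤ C m √N e^{−2πy}`.  Proof: by `hasSum_harmonicSum_dual` and Petersson
(`Σʰ λ_f(m)λ_f(Nn) = δ(m,Nn) − J(m,Nn)`, `‖J(m,Nn)‖ ≤ K m √n`) the `n`-th term is at most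
`√N e^{−2πny}(n^{−1/2} + K m) ≤ (1+K) m √N · n e^{−2πyn}`, and `Σ n rⁿ = r/(1−r)² ≤ 4r` for
`r = e^{−2πy} ≤ ½`; `C = 4(1+K)`.
[cite: Bettin2017, Lemma 2.1] [cite: KowalskiMichel2000, §2.4.2 p. 312] -/
theorem norm_harmonicSum_dual_le (hP : kowalskiMichel2000_peterssonFormula) :
    ∃ C : ℝ, 0 ≤ C ∧ ∀ (N : ℕ) [NeZero N], N.Prime → ∀ m : ℕ, 1 ≤ m → ∀ y : ℝ, 1 ≤ y →
      ‖GL2Family.harmonicSum N 2 (fun f ↦ frickeEigenvalue f * GL2Family.heckeLambda f m *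
          dampedTwist f (fun _ ↦ 1) y)‖ ≤
        C * m * Real.sqrt N * Real.exp (-(2 * Real.pi) * y) := by
  obtain ⟨K, hK0, hK⟩ := norm_petJ_level_mul_le
  refine ⟨4 * (1 + K), by positivity, fun N _ hN m hm y hy ↦ ?_⟩
  have hN0 : (0 : ℝ) < N := by exact_mod_cast hN.pos
  have hm1 : (1 : ℝ) ≤ m := by exact_mod_cast hm
  have hy0 : 0 < y := by linarith
  -- `r = e^{−2πy} ∈ (0, ½]`
  have hr0 : 0 < Real.exp (-(2 * Real.pi) * y) := Real.exp_pos _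
  have hr12 : Real.exp (-(2 * Real.pi) * y) ≤ 1 / 2 := by
    have h1 : Real.exp (-(2 * Real.pi) * y) ≤ Real.exp (-1) :=
      Real.exp_le_exp.mpr (by nlinarith [Real.pi_gt_three])
    have h2 : (2 : ℝ) ≤ Real.exp 1 := by linarith [Real.add_one_le_exp (1 : ℝ)]
    have h3 : Real.exp (-1) ≤ 1 / 2 := by
      rw [Real.exp_neg, one_div]
      exact inv_anti₀ (by norm_num) h2
    exact h1.trans h3
  have hr1 : ‖Real.exp (-(2 * Real.pi) * y)‖ < 1 := by
    rw [Real.norm_of_nonneg hr0.le]; linarith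
  -- the series and its majorant `(1+K) m √N · n rⁿ`
  have hT := hasSum_harmonicSum_dual hN m hy0
  have hG : HasSum (fun n : ℕ ↦ (1 + K) * m * Real.sqrt N * (n * Real.exp (-(2 * Real.pi) * y) ^ n))
      ((1 + K) * m * Real.sqrt N *
        (Real.exp (-(2 * Real.pi) * y) / (1 - Real.exp (-(2 * Real.pi) * y)) ^ 2)) :=
    (hasSum_coe_mul_geometric_of_norm_lt_one hr1).mul_left _
  have hbound : ∀ n : ℕ,
      ‖((-(Real.sqrt ((N : ℝ) * n) * (Real.exp (-(2 * Real.pi * n) * y) / n)) : ℝ) : ℂ) *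
          pet N m (N * n)‖ ≤
        (1 + K) * m * Real.sqrt N * (n * Real.exp (-(2 * Real.pi) * y) ^ n) := by
    intro n
    rcases Nat.eq_zero_or_pos n with rfl | hn
    · simp
    · have hn1 : (1 : ℝ) ≤ n := by exact_mod_cast hn
      have hn0 : (0 : ℝ) < n := by linarith
      -- Petersson: `‖Σʰ λ_f(m)λ_f(Nn)‖ ≤ 1 + K m √n`
      have hpet : ‖pet N m (N * n)‖ ≤ 1 + K * m * Real.sqrt n := by
        have h := (hP N hN m (N * n) hm
          (Nat.one_le_iff_ne_zero.mpr (mul_ne_zero hN.ne_zero hn.ne'))).2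
        rw [h]
        refine (norm_sub_le _ _).trans (add_le_add ?_ (hK N hN m n hm))
        split_ifs <;> simp
      have hexp : Real.exp (-(2 * Real.pi * n) * y) = Real.exp (-(2 * Real.pi) * y) ^ n := by
        rw [← Real.exp_nat_mul]; congr 1; ring
      have hsq : Real.sqrt n / n ≤ 1 := by
        rw [div_le_one hn0, Real.sqrt_le_left hn0.le]; nlinarith
      have hss : Real.sqrt n * Real.sqrt n = n := Real.mul_self_sqrt hn0.le
      have hKm : 1 + K * m ≤ (1 + K) * m * n := by
        nlinarith [mul_nonneg hK0 (by linarith : (0 : ℝ) ≤ m - 1),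
          mul_nonneg (by positivity : (0 : ℝ) ≤ (1 + K) * m) (by linarith : (0 : ℝ) ≤ n - 1)]
      have hw0 : 0 ≤ Real.sqrt N * Real.exp (-(2 * Real.pi) * y) ^ n := by positivity
      rw [norm_mul, Complex.norm_real, Real.norm_eq_abs, abs_neg, abs_of_nonneg (by positivity),
        Real.sqrt_mul hN0.le]
      calc Real.sqrt N * Real.sqrt n * (Real.exp (-(2 * Real.pi * n) * y) / n) * ‖pet N m (N * n)‖
          ≤ Real.sqrt N * Real.sqrt n * (Real.exp (-(2 * Real.pi * n) * y) / n) *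
              (1 + K * m * Real.sqrt n) :=
            mul_le_mul_of_nonneg_left hpet (by positivity)
        _ = Real.sqrt N * Real.exp (-(2 * Real.pi) * y) ^ n *
              (Real.sqrt n / n + K * m * (Real.sqrt n * Real.sqrt n / n)) := by
            rw [hexp]; ring
        _ = Real.sqrt N * Real.exp (-(2 * Real.pi) * y) ^ n * (Real.sqrt n / n + K * m) := by
            rw [hss, div_self hn0.ne', mul_one]
        _ ≤ Real.sqrt N * Real.exp (-(2 * Real.pi) * y) ^ n * (1 + K * m) :=
            mul_le_mul_of_nonneg_left (by linarith) hw0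
        _ ≤ Real.sqrt N * Real.exp (-(2 * Real.pi) * y) ^ n * ((1 + K) * m * n) :=
            mul_le_mul_of_nonneg_left hKm hw0
        _ = (1 + K) * m * Real.sqrt N * (n * Real.exp (-(2 * Real.pi) * y) ^ n) := by ring
  have hle := hT.norm_le_of_bounded hG hbound
  refine hle.trans ?_
  -- `r/(1−r)² ≤ 4r`
  have hgeom : Real.exp (-(2 * Real.pi) * y) / (1 - Real.exp (-(2 * Real.pi) * y)) ^ 2 ≤
      4 * Real.exp (-(2 * Real.pi) * y) := by
    have h1r : (1 : ℝ) / 2 ≤ 1 - Real.exp (-(2 * Real.pi) * y) := by linarith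
    have hpos : (0 : ℝ) < (1 - Real.exp (-(2 * Real.pi) * y)) ^ 2 := pow_pos (by linarith) 2
    rw [div_le_iff₀ hpos]
    nlinarith [mul_nonneg hr0.le (by nlinarith [h1r] :
      (0 : ℝ) ≤ 4 * (1 - Real.exp (-(2 * Real.pi) * y)) ^ 2 - 1)]
  calc (1 + K) * m * Real.sqrt N *
        (Real.exp (-(2 * Real.pi) * y) / (1 - Real.exp (-(2 * Real.pi) * y)) ^ 2)
      ≤ (1 + K) * m * Real.sqrt N * (4 * Real.exp (-(2 * Real.pi) * y)) :=
        mul_le_mul_of_nonneg_left hgeom (by positivity)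
    _ = 4 * (1 + K) * m * Real.sqrt N * Real.exp (-(2 * Real.pi) * y) := by ring

/-- `m √N e^{−2π m N} ≤ 6 m^{1/2} N^{−2}` for real `m, N ≥ 1` (`x e^{−x} ≤ 6/x²`, `x = mN ≥ N`).
[folklore] -/
private theorem mul_sqrt_mul_exp_le {m N : ℝ} (hm : 1 ≤ m) (hN : 1 ≤ N) :
    m * Real.sqrt N * Real.exp (-(2 * Real.pi) * (m * N)) ≤
      6 * m ^ (1 / 2 : ℝ) * N ^ (-(2 : ℝ)) := by
  have hm0 : 0 < m := by linarith
  have hN0 : 0 < N := by linarith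
  have hxN : N ≤ m * N := by nlinarith
  have hx0 : 0 < m * N := by positivity
  -- `e^{−2πx} ≤ e^{−x}` and `x³ e^{−x} ≤ 6`
  have h1 : Real.exp (-(2 * Real.pi) * (m * N)) ≤ Real.exp (-(m * N)) :=
    Real.exp_le_exp.mpr (by nlinarith [Real.pi_gt_three])
  have h2 : (m * N) ^ 3 * Real.exp (-(m * N)) ≤ 6 := by
    have h := Real.pow_div_factorial_le_exp (m * N) hx0.le 3
    have h6 : ((Nat.factorial 3 : ℕ) : ℝ) = 6 := by norm_num [Nat.factorial]
    rw [h6, div_le_iff₀ (by norm_num : (0 : ℝ) < 6)] at h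
    rw [Real.exp_neg, ← div_eq_mul_inv, div_le_iff₀ (Real.exp_pos _)]
    linarith
  have h3 : Real.sqrt N ≤ N := by
    rw [Real.sqrt_le_left hN0.le]; nlinarith
  have h4 : (1 : ℝ) ≤ m ^ (1 / 2 : ℝ) := Real.one_le_rpow hm (by norm_num)
  have h5 : N ^ (-(2 : ℝ)) = (N ^ 2)⁻¹ := by rw [Real.rpow_neg hN0.le, Real.rpow_two]
  calc m * Real.sqrt N * Real.exp (-(2 * Real.pi) * (m * N))
      ≤ m * N * Real.exp (-(m * N)) := by
        gcongr
    _ = (m * N) ^ 3 * Real.exp (-(m * N)) / (m * N) ^ 2 := by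
        rw [eq_div_iff (by positivity)]
        ring
    _ ≤ 6 / (m * N) ^ 2 := by
        gcongr
    _ ≤ 6 / N ^ 2 := by
        gcongr
    _ = 6 * 1 * N ^ (-(2 : ℝ)) := by rw [h5]; ring
    _ ≤ 6 * m ^ (1 / 2 : ℝ) * N ^ (-(2 : ℝ)) := by
        gcongr

/-- **Stub S5 `stub_dualTail` of the I2 skeleton `hecke_afe_petersson`, in its registered shape:
the dual piece is negligible, GIVEN Petersson's formula.**  If Kowalski–Michel's Petersson formula
at prime level holds (`kowalskiMichel2000_peterssonFormula`, input I1), then there are `C, N₀` with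
`‖Σʰ_{f ∈ S_2(N)^*} ε_f λ_f(m) D_f(mN)‖ ≤ C m^{1/2} N^{−2}` for all primes `N ≥ N₀` and all `m ≥ 1`
(`D_f = dampedTwist f 1`, the dual cutoff being `e^{−2πnmN}`; here `N₀ = 1`, `C = 24(1+K)`).
This is the `ε_f`-term of the exact central-value formula at height `y = 1/(mN²)`, the substitute
for the discarded dual integral of Bettin's Lemma 2.1. [cite: Bettin2017, Lemma 2.1]
[cite: KowalskiMichel2000, §2.4.2 p. 312] -/
theorem dualTail_of_peterssonFormula :
    KowalskiMichel2000.kowalskiMichel2000_peterssonFormula →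
      ∃ C : ℝ, ∃ N₀ : ℕ, ∀ (N : ℕ) [NeZero N], N.Prime → N₀ ≤ N → ∀ m : ℕ, 1 ≤ m →
        ‖GL2Family.harmonicSum N 2
            (fun f ↦ frickeEigenvalue f * GL2Family.heckeLambda f m *
              dampedTwist f (fun _ ↦ 1) ((m : ℝ) * N))‖ ≤
          C * (m : ℝ) ^ (1 / 2 : ℝ) * (N : ℝ) ^ (-(2 : ℝ)) := by
  intro hP
  obtain ⟨C, hC0, hC⟩ := norm_harmonicSum_dual_le hP
  refine ⟨6 * C, 1, fun N _ hN _ m hm ↦ ?_⟩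
  have hN1 : (1 : ℝ) ≤ N := by exact_mod_cast hN.one_lt.le
  have hm1 : (1 : ℝ) ≤ m := by exact_mod_cast hm
  have hy : (1 : ℝ) ≤ (m : ℝ) * N := by nlinarith
  have key := mul_sqrt_mul_exp_le hm1 hN1
  calc ‖GL2Family.harmonicSum N 2 (fun f ↦ frickeEigenvalue f * GL2Family.heckeLambda f m *
          dampedTwist f (fun _ ↦ 1) ((m : ℝ) * N))‖
      ≤ C * m * Real.sqrt N * Real.exp (-(2 * Real.pi) * ((m : ℝ) * N)) := hC N hN m hm _ hy
    _ = C * ((m : ℝ) * Real.sqrt N * Real.exp (-(2 * Real.pi) * ((m : ℝ) * N))) := by ring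
    _ ≤ C * (6 * (m : ℝ) ^ (1 / 2 : ℝ) * (N : ℝ) ^ (-(2 : ℝ))) :=
        mul_le_mul_of_nonneg_left key hC0
    _ = 6 * C * (m : ℝ) ^ (1 / 2 : ℝ) * (N : ℝ) ^ (-(2 : ℝ)) := by ring

end Bettin2017

end Literature.NumberTheory.LFunctions

end
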